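import Summits.KontsevichZagierPeriods.KontsevichZagierPeriods.Theorems.ResidualBeyondGenusZero.Negative.WindowInvariant
import Literature.Barriers.KontsevichZagierPeriods.AlgebraicPrimitivesObstruction
import Literature.NumberTheory.Transcendental.SemialgebraicMapsSmoothProofs

/-!
# `ResidualBeyondGenusZero` (stmt-KontsevichZagierPeriods-3917): negative side, IV — rule (2) is load-bearing

Landed copy of §7.4, §7.6–7.7 of the crux work file `Cruxes/ResidualBeyondGenusZero/Disproof.lean`
(cdisprove seat, generation 1). MAIN RESULT `residual_false_without_changeOfVariables`: with
`KZ.relations` replaced by the sub-calculus generated by the additivity moves (1a), (1b) and the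
Newton–Leibniz moves (3), the residual is FALSE, with a NON-degenerate witness: the vanishing
combination `[W₁] − [W₂]`, `W₁ = [[3,4], 1/(t−5)]`, `W₂ = [[0,1], 1/(t−2)]` its translate by `−3`
(one change of variables in the full calculus; both values `∫_{−2}^{−1} dx/x = −log 2`), has no
genus-zero normal form modulo (1a)+(1b)+(3). Proof: the window class of `WindowInvariant.lean`
kills the sub-calculus; genus-zero classes have zero window evaluation off `(0,1)` (§7.4); so the
window functional `A ↦ ∫_{A ∩ [3,4]} dt/(t−5)` would be locally primitive, i.e. `1/(t−5)` would be
a.e. the derivative of a `ℚ`-semialgebraic `F` on some rational interval inside `(3,4)`; `F` is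
smooth off a nowhere dense set (`IsSemialgebraicFunOn.exists_contDiffOn_holds`), so the identity
holds everywhere on a sub-interval; an affine rescaling to `[0,1]` then contradicts the barrier
`AlgebraicPrimitivesObstruction` (general simple-pole descent
`NoSemialgPrimKernel.eq_zero_of_evalEval_eq_zero`: no function algebraic over `ℝ(t)` has a
derivative with a non-zero residue). So any genus-zero normal form of `[W₁] − [W₂]` uses rule (2):
translation invariance is not a consequence of additivity, Newton–Leibniz and the genus-zero
classes. Sources: Kontsevich–Zagier 2001, §1.2; Ayoub 2015, Rem. 1.2; Fresán 2024, Rem. 3.6. -/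

noncomputable section

open MeasureTheory Set
open Literature.NumberTheory.Transcendental

namespace Summit.KontsevichZagierPeriods.ResidualBeyondGenusZero.Negative

open Summit.KontsevichZagierPeriods.DihedralNormalForm.Negative (simplex IsGenusZero relationsWithoutCoV)

/-! ## §7.4 Genus-zero classes live over `(0,1)` on the first axis -/

/-- A genus-zero representation has zero window evaluation on every window missing `(0,1)`. -/
theorem windowEval_of_eq_zero_of_isGenusZero {k : ℕ} {r : KZ.IntegralRep k} (hr : IsGenusZero r)
    {A : MSet} (hA : Disjoint A.1 (Ioo 0 1)) : windowEval (KZ.of r) A = 0 := by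
  obtain ⟨p, a, b, c, hdom, -⟩ := hr
  rw [windowEval_of]
  cases k with
  | zero => simp
  | succ m =>
    have : r.domain ∩ firstWindow A.1 (m + 1) = ∅ := by
      rw [hdom, firstWindow_succ]
      ext x
      simp only [simplex, mem_inter_iff, mem_setOf_eq, mem_empty_iff_false, iff_false, not_and]
      intro hx hA0
      exact hA.le_bot ⟨hA0, hx.1 0, hx.2.1 0⟩
    rw [this]; simp

/-- Hence so does every element of the genus-zero closure. -/
theorem windowEval_eq_zero_of_mem_closure {c₀ : KZ.FormalRep}
    (h : c₀ ∈ AddSubgroup.closure {x | ∃ (k : ℕ) (r : KZ.IntegralRep k), IsGenusZero r ∧ x = KZ.of r})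
    {A : MSet} (hA : Disjoint A.1 (Ioo 0 1)) : windowEval c₀ A = 0 := by
  induction h using AddSubgroup.closure_induction with
  | mem x hx =>
    obtain ⟨k, r, hr, rfl⟩ := hx
    exact windowEval_of_eq_zero_of_isGenusZero hr hA
  | zero => simp
  | add x y _ _ hx hy => simp [hx, hy]
  | neg x _ hx => simp [hx]

/-! ## §7.6 The witness pair `∫₃⁴ dt/(t − 5)` and `∫₀¹ dt/(t − 2)` (translates; both `−log 2`) -/

/-- The rational slab as a product of intervals (for compactness). -/
theorem slab_eq_pi (a b : ℝ) :
    {z : Fin 1 → ℝ | z 0 ∈ Icc a b} = Set.pi univ fun _ => Icc a b := by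
  ext z
  simp only [mem_setOf_eq, mem_pi, mem_univ, forall_const, Fin.forall_fin_one]

/-- Transport of slab integrals to the line. -/
theorem setIntegral_slab_eq (f : ℝ → ℝ) {B : Set ℝ} (_hB : MeasurableSet B) :
    ∫ z in {z : Fin 1 → ℝ | z 0 ∈ B}, f (z 0) = ∫ t in B, f t := by
  have h := (volume_preserving_funUnique (Fin 1) ℝ).setIntegral_preimage_emb
    (MeasurableEquiv.funUnique (Fin 1) ℝ).measurableEmbedding f B
  rw [MeasurableEquiv.funUnique_apply] at h
  exact h

/-- The representation `[[a, b], 1/(t − p)]` for rationals `a ≤ b` and a rational pole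
`p ∉ [a, b]` (KZ-literal data `1 / (X₀ − p)` on the slab `{z | z₀ ∈ [a, b]} ⊂ ℝ¹`). -/
def invRep (a b p : ℚ) (hp : (p : ℝ) ∉ Icc (a : ℝ) b) : KZ.IntegralRep 1 :=
  KZ.IntegralRep.ofRational {z : Fin 1 → ℝ | z 0 ∈ Icc (a : ℝ) b} 1
    (MvPolynomial.X 0 - MvPolynomial.C p) (isSemialgebraic_slab a b)
    (fun z hz => by
      simp only [map_sub, MvPolynomial.aeval_X, MvPolynomial.aeval_C, eq_ratCast, ne_eq, sub_eq_zero]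
      intro h
      exact hp (h ▸ hz))
    (by
      have hK : IsCompact {z : Fin 1 → ℝ | z 0 ∈ Icc (a : ℝ) b} := by
        rw [slab_eq_pi]; exact isCompact_univ_pi fun _ => isCompact_Icc
      refine ContinuousOn.integrableOn_compact hK ?_
      have hfun : (fun x : Fin 1 → ℝ => MvPolynomial.aeval x (1 : MvPolynomial (Fin 1) ℚ) /
          MvPolynomial.aeval x (MvPolynomial.X 0 - MvPolynomial.C p : MvPolynomial (Fin 1) ℚ)) =
          fun z : Fin 1 → ℝ => 1 / (z 0 - (p : ℝ)) := by
        funext z; simp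
      rw [hfun]
      refine ContinuousOn.div continuousOn_const
        (((continuous_apply 0).continuousOn).sub continuousOn_const) fun z hz => ?_
      rw [sub_ne_zero]
      intro h
      exact hp (h ▸ hz))

/-- The domain of `[[a,b], 1/(t − p)]`. -/
theorem invRep_domain (a b p : ℚ) (hp : (p : ℝ) ∉ Icc (a : ℝ) b) :
    (invRep a b p hp).domain = {z : Fin 1 → ℝ | z 0 ∈ Icc (a : ℝ) b} := rfl

/-- The integrand of `[[a,b], 1/(t − p)]`. -/
theorem invRep_integrand (a b p : ℚ) (hp : (p : ℝ) ∉ Icc (a : ℝ) b) (z : Fin 1 → ℝ) :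
    (invRep a b p hp).integrand z = 1 / (z 0 - p) := by
  simp [invRep]

/-- `value [[a,b], 1/(t − p)] = ∫_{a−p}^{b−p} dx/x`. -/
theorem invRep_value (a b p : ℚ) (hp : (p : ℝ) ∉ Icc (a : ℝ) b) (hab : (a : ℝ) ≤ b) :
    (invRep a b p hp).value = ∫ x in ((a : ℝ) - p)..((b : ℝ) - p), 1 / x := by
  rw [KZ.IntegralRep.value, invRep_domain]
  have h1 : (fun z => (invRep a b p hp).integrand z) = fun z : Fin 1 → ℝ => (fun t : ℝ => 1 / (t - p)) (z 0) :=
    funext fun z => invRep_integrand a b p hp z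
  rw [h1, setIntegral_slab_eq (fun t : ℝ => 1 / (t - p)) measurableSet_Icc,
    integral_Icc_eq_integral_Ioc, ← intervalIntegral.integral_of_le hab,
    ← intervalIntegral.integral_comp_sub_right (fun x : ℝ => 1 / x) (p : ℝ)]

/-- `5 ∉ [3, 4]`. -/
theorem five_notMem : ((5 : ℚ) : ℝ) ∉ Icc ((3 : ℚ) : ℝ) ((4 : ℚ) : ℝ) := by norm_num
/-- `2 ∉ [0, 1]`. -/
theorem two_notMem : ((2 : ℚ) : ℝ) ∉ Icc ((0 : ℚ) : ℝ) ((1 : ℚ) : ℝ) := by norm_num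

/-- `W₁ = [[3,4], 1/(t−5)]`. -/
def repW₁ : KZ.IntegralRep 1 := invRep 3 4 5 five_notMem
/-- `W₂ = [[0,1], 1/(t−2)]`, the translate of `W₁` by `−3`. -/
def repW₂ : KZ.IntegralRep 1 := invRep 0 1 2 two_notMem

/-- The two translates have the same value (`∫_{−2}^{−1} dx/x = −log 2`), so `[W₁] − [W₂] ∈ ker eval`
(in the full calculus it is ONE change of variables `t ↦ t − 3`). -/
theorem eval_sub_eq_zero : KZ.eval (KZ.of repW₁ - KZ.of repW₂) = 0 := by
  rw [map_sub, KZ.eval_of, KZ.eval_of, repW₁, repW₂, invRep_value _ _ _ _ (by norm_num),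
    invRep_value _ _ _ _ (by norm_num)]
  norm_num

/-! ## §7.7 The endgame: no change of variables ⇒ a semialgebraic primitive of `1/(t − 5)` -/

/-- Inside `(3,4)` there is a rational closed interval missing any given finite set. -/
theorem exists_rat_Icc_disjoint (E : Finset ℝ) :
    ∃ α β : ℚ, (α : ℝ) < β ∧ (3 : ℝ) < α ∧ (β : ℝ) < 4 ∧ Disjoint (Icc (α : ℝ) β) (E : Set ℝ) := by
  obtain ⟨t, ht, htE⟩ := (Set.Ioo_infinite (by norm_num : (3 : ℝ) < 4)).exists_notMem_finset E
  have hopen : IsOpen (Ioo (3 : ℝ) 4 \ (E : Set ℝ)) := isOpen_Ioo.sdiff E.finite_toSet.isClosed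
  obtain ⟨ε, hε, hball⟩ := Metric.isOpen_iff.1 hopen t ⟨ht, htE⟩
  obtain ⟨α, hα₁, hα₂⟩ := exists_rat_btwn (show t - ε / 2 < t by linarith)
  obtain ⟨β, hβ₁, hβ₂⟩ := exists_rat_btwn (show t < t + ε / 2 by linarith)
  have hsub : Icc (α : ℝ) β ⊆ Ioo (3 : ℝ) 4 \ (E : Set ℝ) := fun x hx => hball (by
    rw [Metric.mem_ball, Real.dist_eq, abs_lt]
    constructor <;> linarith [hx.1, hx.2])
  refine ⟨α, β, by exact_mod_cast hα₂.trans hβ₁, (hsub ⟨le_rfl, ?_⟩).1.1, (hsub ⟨?_, le_rfl⟩).1.2,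
    Set.disjoint_left.2 fun x hx hxE => (hsub hx).2 hxE⟩
  · exact_mod_cast (hα₂.trans hβ₁).le
  · exact_mod_cast (hα₂.trans hβ₁).le

/-- Two functions continuous on an open interval that agree off a null set agree everywhere. -/
theorem eqOn_of_continuousOn_of_null {u v : ℝ → ℝ} {a b : ℝ}
    (hu : ContinuousOn u (Ioo a b)) (hv : ContinuousOn v (Ioo a b))
    (h0 : volume {t | t ∈ Ioo a b ∧ u t ≠ v t} = 0) : EqOn u v (Ioo a b) := by
  intro t₀ ht₀
  by_contra hne
  have hcont : ContinuousAt (fun t => u t - v t) t₀ :=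
    ((hu.sub hv).continuousWithinAt ht₀).continuousAt (isOpen_Ioo.mem_nhds ht₀)
  have hev : ∀ᶠ t in nhds t₀, u t - v t ≠ 0 ∧ t ∈ Ioo a b :=
    (hcont.eventually_ne (sub_ne_zero.2 hne)).and (isOpen_Ioo.mem_nhds ht₀)
  obtain ⟨δ, hδ, hδsub⟩ := Metric.eventually_nhds_iff_ball.1 hev
  have hsub : Metric.ball t₀ δ ⊆ {t | t ∈ Ioo a b ∧ u t ≠ v t} := fun t ht =>
    ⟨(hδsub t ht).2, sub_ne_zero.1 (hδsub t ht).1⟩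
  have hball0 : volume (Metric.ball t₀ δ) = 0 := measure_mono_null hsub h0
  rw [Real.volume_ball] at hball0
  exact (ENNReal.ofReal_pos.2 (by linarith : (0 : ℝ) < 2 * δ)).ne' hball0

/-- The genus-zero generator set (as in the companion file). -/
def gzGens : Set KZ.FormalRep := {x | ∃ (k : ℕ) (r : KZ.IntegralRep k), IsGenusZero r ∧ x = KZ.of r}

/-- **The crux WITHOUT rule (2)**: `KZ.relations` replaced by the sub-calculus (1a)+(1b)+(3). -/
def ResidualWithoutChangeOfVariables : Prop :=
  ∀ c : KZ.FormalRep, KZ.eval c = 0 →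
    ∃ c₀ ∈ AddSubgroup.closure gzGens, c - c₀ ∈ relationsWithoutCoV

/-- **Rule (2) is load-bearing for the residual.** The vanishing combination `[W₁] − [W₂]`
(`∫₃⁴ dt/(t−5)` minus its translate `∫₀¹ dt/(t−2)`, one change of variables in the full calculus)
has NO genus-zero normal form in the sub-calculus generated by the additivity and Newton–Leibniz
moves: the first-coordinate window class `windowClass` kills that sub-calculus, the genus-zero
closure has zero window evaluation off `(0,1)`, so a normal form would make the window functional
`A ↦ ∫_{A ∩ [3,4]} dt/(t − 5)` locally primitive — i.e. give `1/(t − 5)` a `ℚ`-semialgebraic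
primitive on some rational interval, which after an affine rescaling contradicts the barrier
`Literature/Barriers/KontsevichZagierPeriods/AlgebraicPrimitivesObstruction` (no function algebraic
over `ℝ(t)` has a derivative with a non-zero residue). -/
theorem residual_false_without_changeOfVariables : ¬ ResidualWithoutChangeOfVariables := by
  intro h
  obtain ⟨c₀, hc₀, hrel⟩ := h _ eval_sub_eq_zero
  -- (1) the invariant: the window functional of `[W₁] − [W₂] − c₀` is in `primSpan`
  have hcl : windowEval (KZ.of repW₁ - KZ.of repW₂ - c₀) ∈ primSpan :=
    (windowClass_eq_zero_iff _).1
      ((AddMonoidHom.mem_ker).1 (relationsWithoutCoV_le_ker_windowClass hrel))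
  obtain ⟨E, hE⟩ := locallyPrimitive_of_mem_primSpan hcl
  -- (2) a rational interval `[α, β] ⊂ (3,4)` missing the endpoints `E`
  obtain ⟨α, β, hαβ, h3α, hβ4, hdisj⟩ := exists_rat_Icc_disjoint E
  obtain ⟨g, F, hF, hd, hi, hΛ⟩ := hE α β hαβ hdisj
  -- (3) on subsets of `[α, β]` the window functional is `A ↦ ∫_{z₀ ∈ A} 1/(z₀ − 5)`
  have hW : ∀ A : MSet, A.1 ⊆ Icc (α : ℝ) β →
      windowEval (KZ.of repW₁ - KZ.of repW₂ - c₀) A =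
        ∫ z in {z : Fin 1 → ℝ | z 0 ∈ A.1}, (1 / (z 0 - 5) : ℝ) := by
    intro A hA
    have hA34 : A.1 ⊆ Icc (3 : ℝ) 4 := fun t ht => ⟨(h3α.trans_le (hA ht).1).le, ((hA ht).2.trans_lt hβ4).le⟩
    have hdisj01 : Disjoint A.1 (Ioo (0 : ℝ) 1) :=
      Set.disjoint_left.2 fun t ht ht' => by linarith [(hA34 ht).1, ht'.2]
    rw [map_sub, map_sub, Pi.sub_apply, Pi.sub_apply, windowEval_eq_zero_of_mem_closure hc₀ hdisj01,
      sub_zero, windowEval_of, windowEval_of]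
    have h1 : repW₁.domain ∩ firstWindow A.1 1 = {z : Fin 1 → ℝ | z 0 ∈ A.1} := by
      rw [repW₁, invRep_domain, firstWindow_succ]
      ext z
      simp only [mem_inter_iff, mem_setOf_eq, and_iff_right_iff_imp]
      intro hz
      exact_mod_cast hA34 hz
    have h2 : repW₂.domain ∩ firstWindow A.1 1 = ∅ := by
      rw [repW₂, invRep_domain, firstWindow_succ]
      ext z
      simp only [mem_inter_iff, mem_setOf_eq, mem_empty_iff_false, iff_false, not_and]
      intro hz hzA
      have := (hA34 hzA).1
      have := hz.2
      push_cast at this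
      linarith
    rw [h1, h2, Measure.restrict_empty, integral_zero_measure, sub_zero]
    refine setIntegral_congr_fun (measurable_pi_apply 0 A.2) fun z _ => ?_
    rw [repW₁, invRep_integrand]
    push_cast
    ring
  -- (4) hence `g = 1/(z₀ − 5)` a.e. on the slab over `[α, β]`
  set slab : Set (Fin 1 → ℝ) := {z | z 0 ∈ Icc (α : ℝ) β} with hslab
  have hslabm : MeasurableSet slab := measurable_pi_apply 0 measurableSet_Icc
  have hwi : IntegrableOn (fun z : Fin 1 → ℝ => (1 / (z 0 - 5) : ℝ)) slab := by
    have hK : IsCompact slab := by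
      rw [hslab, slab_eq_pi]; exact isCompact_univ_pi fun _ => isCompact_Icc
    refine ContinuousOn.integrableOn_compact hK (ContinuousOn.div continuousOn_const
      (((continuous_apply 0).continuousOn).sub continuousOn_const) fun z hz h0 => ?_)
    linarith [hz.2, sub_eq_zero.1 h0]
  have hae : (fun z : Fin 1 → ℝ => (1 / (z 0 - 5) : ℝ)) =ᵐ[volume.restrict slab] g := by
    refine Integrable.ae_eq_of_forall_setIntegral_eq _ _ hwi hi fun s hs _ => ?_
    -- `s ∩ slab` is a first-coordinate set `{z | z 0 ∈ A}` with `A ⊆ [α, β]` measurable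
    set A : Set ℝ := {t | t ∈ Icc (α : ℝ) β ∧ (fun _ : Fin 1 => t) ∈ s} with hAdef
    have hAm : MeasurableSet A :=
      measurableSet_Icc.inter ((measurable_pi_lambda _ fun _ => measurable_id) hs)
    have hAsub : A ⊆ Icc (α : ℝ) β := fun t ht => ht.1
    have hsA : s ∩ slab = {z : Fin 1 → ℝ | z 0 ∈ A} := by
      ext z
      have hz : (fun _ : Fin 1 => z 0) = z := by funext i; rw [Fin.fin_one_eq_zero i]
      simp only [mem_inter_iff, hslab, mem_setOf_eq, hAdef, hz]
      tauto
    rw [Measure.restrict_restrict hs, hsA, ← hW ⟨A, hAm⟩ hAsub, hΛ ⟨A, hAm⟩ hAsub]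
  -- (5) the smooth locus of `F` inside the open slab: an open sub-interval `V`
  set U : Set (Fin 1 → ℝ) := {z | z 0 ∈ Ioo (α : ℝ) β} with hU
  have hUo : IsOpen U := isOpen_Ioo.preimage (continuous_apply 0)
  have hUsa : Literature.ModelTheory.ExponentialFields.IsSemialgebraic ℚ U := by
    have h1 := Literature.ModelTheory.ExponentialFields.isSemialgebraic_setOf_eval_pos (k := ℚ) (R := ℝ)
      (MvPolynomial.X 0 - MvPolynomial.C α : MvPolynomial (Fin 1) ℚ)
    have h2 := Literature.ModelTheory.ExponentialFields.isSemialgebraic_setOf_eval_pos (k := ℚ) (R := ℝ)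
      (MvPolynomial.C β - MvPolynomial.X 0 : MvPolynomial (Fin 1) ℚ)
    convert h1.inter h2 using 1
    ext z
    simp [hU, sub_pos]
  have hFU : IsSemialgebraicFunOn ℚ U F := hF.mono (fun z hz => Ioo_subset_Icc_self hz) hUsa
  obtain ⟨Z, hZU, -, hZint, hUZo, hsmooth⟩ := IsSemialgebraicFunOn.exists_contDiffOn_holds hUo hFU
  have hne : (U \ Z).Nonempty := by
    by_contra hempty
    rw [Set.not_nonempty_iff_eq_empty, Set.sdiff_eq_empty] at hempty
    have hmid : (fun _ : Fin 1 => ((α : ℝ) + β) / 2) ∈ interior Z := by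
      apply interior_mono hempty
      rw [hUo.interior_eq]
      show ((α : ℝ) + β) / 2 ∈ Ioo (α : ℝ) β
      constructor <;> linarith
    rw [hZint] at hmid
    exact hmid
  obtain ⟨z₁, hz₁⟩ := hne
  obtain ⟨ε, hε, hballsub⟩ := Metric.isOpen_iff.1 hUZo z₁ hz₁
  set t₁ : ℝ := z₁ 0 with ht₁
  have hz₁eq : z₁ = fun _ => t₁ := by funext i; rw [Fin.fin_one_eq_zero i]
  have hconst_mem : ∀ t ∈ Ioo (t₁ - ε) (t₁ + ε), (fun _ : Fin 1 => t) ∈ U \ Z := by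
    intro t ht
    apply hballsub
    rw [Metric.mem_ball, hz₁eq, dist_pi_lt_iff hε]
    intro i
    rw [Real.dist_eq, abs_lt]
    constructor <;> linarith [ht.1, ht.2]
  have hVU : ∀ t ∈ Ioo (t₁ - ε) (t₁ + ε), t ∈ Ioo (α : ℝ) β := fun t ht => (hconst_mem t ht).1
  -- (6) on `V`, `t ↦ F (const t)` is smooth, so its derivative `t ↦ g (const t)` is continuous
  set φ : ℝ → ℝ := fun t => F (fun _ => t) with hφ
  have hφs : ContDiffOn ℝ ((⊤ : ℕ∞) : WithTop ℕ∞) φ (Ioo (t₁ - ε) (t₁ + ε)) := by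
    have hc : ContDiffOn ℝ ((⊤ : ℕ∞) : WithTop ℕ∞) (fun t : ℝ => (fun _ : Fin 1 => t))
        (Ioo (t₁ - ε) (t₁ + ε)) :=
      (contDiff_pi.2 fun _ => contDiff_id).contDiffOn
    exact hsmooth.comp hc fun t ht => hconst_mem t ht
  have hderφ : ∀ t ∈ Ioo (t₁ - ε) (t₁ + ε), deriv φ t = g (fun _ => t) :=
    fun t ht => (hd t (hVU t ht)).deriv
  have hgc : ContinuousOn (fun t : ℝ => g (fun _ => t)) (Ioo (t₁ - ε) (t₁ + ε)) :=
    (hφs.continuousOn_deriv_of_isOpen isOpen_Ioo (by simp)).congr fun t ht => (hderφ t ht).symm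
  have hwc : ContinuousOn (fun t : ℝ => (1 / (t - 5) : ℝ)) (Ioo (t₁ - ε) (t₁ + ε)) := by
    refine ContinuousOn.div continuousOn_const (continuousOn_id.sub continuousOn_const) fun t ht h0 => ?_
    linarith [(hVU t ht).2, sub_eq_zero.1 h0]
  -- (7) `g (const t) = 1/(t − 5)` a.e. on `[α, β]` (transport of (4) to the line), hence on all of `V`
  have hnull : volume {t : ℝ | t ∈ Ioo (t₁ - ε) (t₁ + ε) ∧ (1 / (t - 5) : ℝ) ≠ g (fun _ => t)} = 0 := by
    have h0 : volume ({z : Fin 1 → ℝ | (1 / (z 0 - 5) : ℝ) ≠ g z} ∩ slab) = 0 := by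
      have := ae_iff.1 hae
      rwa [Measure.restrict_apply' hslabm] at this
    set e := MeasurableEquiv.funUnique (Fin 1) ℝ with he
    have hmp : MeasurePreserving e volume volume := volume_preserving_funUnique (Fin 1) ℝ
    have hpre : e ⁻¹' {t : ℝ | t ∈ Icc (α : ℝ) β ∧ (1 / (t - 5) : ℝ) ≠ g (fun _ => t)} =
        {z : Fin 1 → ℝ | (1 / (z 0 - 5) : ℝ) ≠ g z} ∩ slab := by
      ext z
      have hz : (fun _ : Fin 1 => z 0) = z := by funext i; rw [Fin.fin_one_eq_zero i]
      simp only [he, MeasurableEquiv.funUnique_apply, mem_preimage, mem_setOf_eq, mem_inter_iff, hslab]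
      rw [show (default : Fin 1) = 0 from rfl, hz]
      tauto
    have h1 : volume {t : ℝ | t ∈ Icc (α : ℝ) β ∧ (1 / (t - 5) : ℝ) ≠ g (fun _ => t)} = 0 := by
      rw [← hmp.map_eq, MeasurableEquiv.map_apply, hpre, h0]
    refine measure_mono_null ?_ h1
    intro t ht
    exact ⟨Ioo_subset_Icc_self (hVU t ht.1), ht.2⟩
  have heq : EqOn (fun t : ℝ => (1 / (t - 5) : ℝ)) (fun t => g (fun _ => t)) (Ioo (t₁ - ε) (t₁ + ε)) :=
    eqOn_of_continuousOn_of_null hwc hgc hnull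
  have hderiv5 : ∀ t ∈ Ioo (t₁ - ε) (t₁ + ε), HasDerivAt φ (1 / (t - 5)) t := fun t ht =>
    (hd t (hVU t ht)).congr_deriv (heq ht).symm
  -- (8) a rational closed sub-interval `[α₂, β₂] ⊂ V` and the affine rescaling to `[0, 1]`
  obtain ⟨α₂, hα₂l, hα₂r⟩ := exists_rat_btwn (show t₁ - ε < t₁ by linarith)
  obtain ⟨β₂, hβ₂l, hβ₂r⟩ := exists_rat_btwn (show t₁ < t₁ + ε by linarith)
  have hαβ₂ : (α₂ : ℝ) < β₂ := hα₂r.trans hβ₂l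
  set lam : ℚ := β₂ - α₂ with hlam
  have hlam0 : (0 : ℝ) < lam := by rw [hlam]; push_cast; linarith
  set Φ : (Fin 1 → ℝ) → (Fin 1 → ℝ) := fun x _ => (α₂ : ℝ) + (lam : ℝ) * x 0 with hΦ
  have h01sa : Literature.ModelTheory.ExponentialFields.IsSemialgebraic ℚ {x : Fin 1 → ℝ | x 0 ∈ Icc (0 : ℝ) 1} := by
    simpa using isSemialgebraic_slab 0 1
  have hΦsa : IsSemialgebraicMapOn ℚ {x : Fin 1 → ℝ | x 0 ∈ Icc (0 : ℝ) 1} Φ := by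
    refine (isSemialgebraicMapOn_aeval h01sa
      (fun _ => MvPolynomial.C α₂ + MvPolynomial.C lam * MvPolynomial.X 0 : Fin 1 → MvPolynomial (Fin 1) ℚ)).congr
      fun x _ => ?_
    funext j
    simp [hΦ]
  have hΦmaps : MapsTo Φ {x : Fin 1 → ℝ | x 0 ∈ Icc (0 : ℝ) 1} slab := by
    intro x hx
    simp only [hΦ, hslab, mem_setOf_eq, mem_Icc]
    have h0 := hx.1
    have h1 := hx.2
    have hαα₂ : (α : ℝ) < α₂ := (hVU α₂ ⟨hα₂l, by linarith⟩).1
    have hβ₂β : (β₂ : ℝ) < β := (hVU β₂ ⟨by linarith, hβ₂r⟩).2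
    have hlamR : (lam : ℝ) = β₂ - α₂ := by rw [hlam]; push_cast; ring
    constructor <;> nlinarith
  have hFΦ : IsSemialgebraicFunOn ℚ {x : Fin 1 → ℝ | x 0 ∈ Icc (0 : ℝ) 1} (F ∘ Φ) :=
    IsSemialgebraicFunOn.comp_isSemialgebraicMapOn_holds hF hΦsa hΦmaps
  -- the rescaled primitive has derivative `1/(s − x₀)`, `x₀ = (5 − α₂)/λ > 1`, on `(0, 1)`
  set x₀ : ℝ := (5 - α₂) / lam with hx₀
  have hx₀1 : 1 < x₀ := by
    rw [hx₀, lt_div_iff₀ hlam0]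
    have hβ₂4 : (β₂ : ℝ) < 4 := ((hVU β₂ ⟨by linarith, hβ₂r⟩).2).trans hβ4
    have hlamR : (lam : ℝ) = β₂ - α₂ := by rw [hlam]; push_cast; ring
    linarith
  have hG : ∀ s ∈ Ioo (0 : ℝ) 1,
      HasDerivAt (fun s : ℝ => (F ∘ Φ) (fun _ => s)) (1 / (s - x₀)) s := by
    intro s hs
    have hlamR : (lam : ℝ) = β₂ - α₂ := by rw [hlam]; push_cast; ring
    have hts : (α₂ : ℝ) + lam * s ∈ Ioo (t₁ - ε) (t₁ + ε) := by
      constructor <;> nlinarith [hs.1, hs.2]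
    have h1 : HasDerivAt (fun s : ℝ => (α₂ : ℝ) + lam * s) ((lam : ℝ) * 1) s :=
      ((hasDerivAt_id s).const_mul (lam : ℝ)).const_add (α₂ : ℝ)
    have h2 := (hderiv5 _ hts).comp s h1
    have heq : (fun s : ℝ => (F ∘ Φ) (fun _ => s)) = φ ∘ fun s : ℝ => (α₂ : ℝ) + lam * s := by
      funext s; simp [hφ, hΦ]
    rw [heq]
    refine h2.congr_deriv ?_
    have key : s - x₀ = ((α₂ : ℝ) + lam * s - 5) / lam := by
      rw [hx₀]
      field_simp
      ring
    rw [key, one_div_div]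
    ring
  -- (9) the barrier: no `ℚ`-semialgebraic function on `[0,1]` has such a derivative
  obtain ⟨P, hP0, hPv⟩ :=
    Literature.Barriers.KontsevichZagierPeriods.KZ.NoSemialgPrimKernel.exists_ne_zero_evalEval_eq_zero hFΦ
  have hDN : ∀ t ∈ Ioo (0 : ℝ) 1,
      ((Polynomial.X - Polynomial.C x₀) * 1 : Polynomial ℝ).eval t * (1 / (t - x₀)) =
        (1 : Polynomial ℝ).eval t := by
    intro t ht
    have hne' : t - x₀ ≠ 0 := fun h0 => by linarith [sub_eq_zero.1 h0, ht.2.trans hx₀1]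
    simp only [mul_one, Polynomial.eval_sub, Polynomial.eval_X, Polynomial.eval_C, Polynomial.eval_one]
    field_simp
  exact hP0 (Literature.Barriers.KontsevichZagierPeriods.KZ.NoSemialgPrimKernel.eq_zero_of_evalEval_eq_zero
    (G := fun s : ℝ => (F ∘ Φ) (fun _ => s)) (V := 1) (N := 1) (x₀ := x₀) hG hDN
    (by simp) (by simp) P.natDegree P le_rfl (fun t ht => hPv t (Ioo_subset_Icc_self ht)))

end Summit.KontsevichZagierPeriods.ResidualBeyondGenusZero.Negative
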